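import Summits.Ventures.FusionMHD.Bench.SAlphaU067Checks2
import HarnessLib

/-!
# F3 — `s–α` at `(s, α) = (1, 67/100)`: even-solution enclosure transcript, KERNEL CHECK FILE 3/4 (stages 30–44: HOE step test ∧ landing,
# one `decide` per stage)
(venture LADDER-GRIDFUSION, rung F3 — the validated-ODE TWIN of the unstable point `(s, α) = (1, 67/100)` of ★ #192 (TT witness):
instability from a kernel-certified SIGN CHANGE of the even solution through lit-3's conjugate-point socket
`Ballooning.SAlpha.exists_unstableWitnessPW3_of_signChange`; cell `gridfusion`, typed by gridfusion-lit-3 (g13), 2026-08-28; generator =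
lit-3's untrusted Lean-interpreter search `scratch/GenSAlphaChain60u.lean`; 0 `def … : Prop` facts, 0 kit jobs, no `native_decide`, no floating
point.  The per-stage facts are stated through `chain.certAt j` / `chain.initAt (j + 1)` (the transcript's own accessors).)
-/

open NonemptyInterval
open Literature.Analysis.ODE Literature.Analysis.ValidatedNumerics Literature.Analysis.ValidatedNumerics.ITaylor

namespace Summit.Ventures.FusionMHD.Bench.SAlphaU067

/-- Stage 30 of the transcript: the elementary HOE step test AND the landing of its end box in the hand-over box of stage 31 — ONE kernel
evaluation. [cite: Moore1979, §8.1 eq. (8.10) with (8.13)] [cite: NedialkovJacksonCorliss1999, §5 Algorithm I] -/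
theorem uok30 : ((chain.certAt 30).check && boxLE (chain.certAt 30).endBox (chain.initAt 31)) = true := by
  decide +kernel

/-- Stage 30 passes the step test. [cite: Moore1979, §8.1 eq. (8.10) with (8.13)] -/
theorem uok30c : (chain.certAt 30).check = true := (Bool.and_eq_true_iff.1 uok30).1

/-- The end box of stage 30 lands in the hand-over box of stage 31. [cite: NedialkovJacksonCorliss1999, §5 Algorithm I] -/
theorem uok30b : boxLE (chain.certAt 30).endBox (chain.initAt 31) = true := (Bool.and_eq_true_iff.1 uok30).2

/-- Stage 31 of the transcript: the elementary HOE step test AND the landing of its end box in the hand-over box of stage 32 — ONE kernel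
evaluation. [cite: Moore1979, §8.1 eq. (8.10) with (8.13)] [cite: NedialkovJacksonCorliss1999, §5 Algorithm I] -/
theorem uok31 : ((chain.certAt 31).check && boxLE (chain.certAt 31).endBox (chain.initAt 32)) = true := by
  decide +kernel

/-- Stage 31 passes the step test. [cite: Moore1979, §8.1 eq. (8.10) with (8.13)] -/
theorem uok31c : (chain.certAt 31).check = true := (Bool.and_eq_true_iff.1 uok31).1

/-- The end box of stage 31 lands in the hand-over box of stage 32. [cite: NedialkovJacksonCorliss1999, §5 Algorithm I] -/
theorem uok31b : boxLE (chain.certAt 31).endBox (chain.initAt 32) = true := (Bool.and_eq_true_iff.1 uok31).2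

/-- Stage 32 of the transcript: the elementary HOE step test AND the landing of its end box in the hand-over box of stage 33 — ONE kernel
evaluation. [cite: Moore1979, §8.1 eq. (8.10) with (8.13)] [cite: NedialkovJacksonCorliss1999, §5 Algorithm I] -/
theorem uok32 : ((chain.certAt 32).check && boxLE (chain.certAt 32).endBox (chain.initAt 33)) = true := by
  decide +kernel

/-- Stage 32 passes the step test. [cite: Moore1979, §8.1 eq. (8.10) with (8.13)] -/
theorem uok32c : (chain.certAt 32).check = true := (Bool.and_eq_true_iff.1 uok32).1

/-- The end box of stage 32 lands in the hand-over box of stage 33. [cite: NedialkovJacksonCorliss1999, §5 Algorithm I] -/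
theorem uok32b : boxLE (chain.certAt 32).endBox (chain.initAt 33) = true := (Bool.and_eq_true_iff.1 uok32).2

/-- Stage 33 of the transcript: the elementary HOE step test AND the landing of its end box in the hand-over box of stage 34 — ONE kernel
evaluation. [cite: Moore1979, §8.1 eq. (8.10) with (8.13)] [cite: NedialkovJacksonCorliss1999, §5 Algorithm I] -/
theorem uok33 : ((chain.certAt 33).check && boxLE (chain.certAt 33).endBox (chain.initAt 34)) = true := by
  decide +kernel

/-- Stage 33 passes the step test. [cite: Moore1979, §8.1 eq. (8.10) with (8.13)] -/
theorem uok33c : (chain.certAt 33).check = true := (Bool.and_eq_true_iff.1 uok33).1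

/-- The end box of stage 33 lands in the hand-over box of stage 34. [cite: NedialkovJacksonCorliss1999, §5 Algorithm I] -/
theorem uok33b : boxLE (chain.certAt 33).endBox (chain.initAt 34) = true := (Bool.and_eq_true_iff.1 uok33).2

/-- Stage 34 of the transcript: the elementary HOE step test AND the landing of its end box in the hand-over box of stage 35 — ONE kernel
evaluation. [cite: Moore1979, §8.1 eq. (8.10) with (8.13)] [cite: NedialkovJacksonCorliss1999, §5 Algorithm I] -/
theorem uok34 : ((chain.certAt 34).check && boxLE (chain.certAt 34).endBox (chain.initAt 35)) = true := by
  decide +kernel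

/-- Stage 34 passes the step test. [cite: Moore1979, §8.1 eq. (8.10) with (8.13)] -/
theorem uok34c : (chain.certAt 34).check = true := (Bool.and_eq_true_iff.1 uok34).1

/-- The end box of stage 34 lands in the hand-over box of stage 35. [cite: NedialkovJacksonCorliss1999, §5 Algorithm I] -/
theorem uok34b : boxLE (chain.certAt 34).endBox (chain.initAt 35) = true := (Bool.and_eq_true_iff.1 uok34).2

/-- Stage 35 of the transcript: the elementary HOE step test AND the landing of its end box in the hand-over box of stage 36 — ONE kernel
evaluation. [cite: Moore1979, §8.1 eq. (8.10) with (8.13)] [cite: NedialkovJacksonCorliss1999, §5 Algorithm I] -/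
theorem uok35 : ((chain.certAt 35).check && boxLE (chain.certAt 35).endBox (chain.initAt 36)) = true := by
  decide +kernel

/-- Stage 35 passes the step test. [cite: Moore1979, §8.1 eq. (8.10) with (8.13)] -/
theorem uok35c : (chain.certAt 35).check = true := (Bool.and_eq_true_iff.1 uok35).1

/-- The end box of stage 35 lands in the hand-over box of stage 36. [cite: NedialkovJacksonCorliss1999, §5 Algorithm I] -/
theorem uok35b : boxLE (chain.certAt 35).endBox (chain.initAt 36) = true := (Bool.and_eq_true_iff.1 uok35).2

/-- Stage 36 of the transcript: the elementary HOE step test AND the landing of its end box in the hand-over box of stage 37 — ONE kernel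
evaluation. [cite: Moore1979, §8.1 eq. (8.10) with (8.13)] [cite: NedialkovJacksonCorliss1999, §5 Algorithm I] -/
theorem uok36 : ((chain.certAt 36).check && boxLE (chain.certAt 36).endBox (chain.initAt 37)) = true := by
  decide +kernel

/-- Stage 36 passes the step test. [cite: Moore1979, §8.1 eq. (8.10) with (8.13)] -/
theorem uok36c : (chain.certAt 36).check = true := (Bool.and_eq_true_iff.1 uok36).1

/-- The end box of stage 36 lands in the hand-over box of stage 37. [cite: NedialkovJacksonCorliss1999, §5 Algorithm I] -/
theorem uok36b : boxLE (chain.certAt 36).endBox (chain.initAt 37) = true := (Bool.and_eq_true_iff.1 uok36).2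

/-- Stage 37 of the transcript: the elementary HOE step test AND the landing of its end box in the hand-over box of stage 38 — ONE kernel
evaluation. [cite: Moore1979, §8.1 eq. (8.10) with (8.13)] [cite: NedialkovJacksonCorliss1999, §5 Algorithm I] -/
theorem uok37 : ((chain.certAt 37).check && boxLE (chain.certAt 37).endBox (chain.initAt 38)) = true := by
  decide +kernel

/-- Stage 37 passes the step test. [cite: Moore1979, §8.1 eq. (8.10) with (8.13)] -/
theorem uok37c : (chain.certAt 37).check = true := (Bool.and_eq_true_iff.1 uok37).1

/-- The end box of stage 37 lands in the hand-over box of stage 38. [cite: NedialkovJacksonCorliss1999, §5 Algorithm I] -/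
theorem uok37b : boxLE (chain.certAt 37).endBox (chain.initAt 38) = true := (Bool.and_eq_true_iff.1 uok37).2

/-- Stage 38 of the transcript: the elementary HOE step test AND the landing of its end box in the hand-over box of stage 39 — ONE kernel
evaluation. [cite: Moore1979, §8.1 eq. (8.10) with (8.13)] [cite: NedialkovJacksonCorliss1999, §5 Algorithm I] -/
theorem uok38 : ((chain.certAt 38).check && boxLE (chain.certAt 38).endBox (chain.initAt 39)) = true := by
  decide +kernel

/-- Stage 38 passes the step test. [cite: Moore1979, §8.1 eq. (8.10) with (8.13)] -/
theorem uok38c : (chain.certAt 38).check = true := (Bool.and_eq_true_iff.1 uok38).1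

/-- The end box of stage 38 lands in the hand-over box of stage 39. [cite: NedialkovJacksonCorliss1999, §5 Algorithm I] -/
theorem uok38b : boxLE (chain.certAt 38).endBox (chain.initAt 39) = true := (Bool.and_eq_true_iff.1 uok38).2

/-- Stage 39 of the transcript: the elementary HOE step test AND the landing of its end box in the hand-over box of stage 40 — ONE kernel
evaluation. [cite: Moore1979, §8.1 eq. (8.10) with (8.13)] [cite: NedialkovJacksonCorliss1999, §5 Algorithm I] -/
theorem uok39 : ((chain.certAt 39).check && boxLE (chain.certAt 39).endBox (chain.initAt 40)) = true := by
  decide +kernel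

/-- Stage 39 passes the step test. [cite: Moore1979, §8.1 eq. (8.10) with (8.13)] -/
theorem uok39c : (chain.certAt 39).check = true := (Bool.and_eq_true_iff.1 uok39).1

/-- The end box of stage 39 lands in the hand-over box of stage 40. [cite: NedialkovJacksonCorliss1999, §5 Algorithm I] -/
theorem uok39b : boxLE (chain.certAt 39).endBox (chain.initAt 40) = true := (Bool.and_eq_true_iff.1 uok39).2

/-- Stage 40 of the transcript: the elementary HOE step test AND the landing of its end box in the hand-over box of stage 41 — ONE kernel
evaluation. [cite: Moore1979, §8.1 eq. (8.10) with (8.13)] [cite: NedialkovJacksonCorliss1999, §5 Algorithm I] -/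
theorem uok40 : ((chain.certAt 40).check && boxLE (chain.certAt 40).endBox (chain.initAt 41)) = true := by
  decide +kernel

/-- Stage 40 passes the step test. [cite: Moore1979, §8.1 eq. (8.10) with (8.13)] -/
theorem uok40c : (chain.certAt 40).check = true := (Bool.and_eq_true_iff.1 uok40).1

/-- The end box of stage 40 lands in the hand-over box of stage 41. [cite: NedialkovJacksonCorliss1999, §5 Algorithm I] -/
theorem uok40b : boxLE (chain.certAt 40).endBox (chain.initAt 41) = true := (Bool.and_eq_true_iff.1 uok40).2

/-- Stage 41 of the transcript: the elementary HOE step test AND the landing of its end box in the hand-over box of stage 42 — ONE kernel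
evaluation. [cite: Moore1979, §8.1 eq. (8.10) with (8.13)] [cite: NedialkovJacksonCorliss1999, §5 Algorithm I] -/
theorem uok41 : ((chain.certAt 41).check && boxLE (chain.certAt 41).endBox (chain.initAt 42)) = true := by
  decide +kernel

/-- Stage 41 passes the step test. [cite: Moore1979, §8.1 eq. (8.10) with (8.13)] -/
theorem uok41c : (chain.certAt 41).check = true := (Bool.and_eq_true_iff.1 uok41).1

/-- The end box of stage 41 lands in the hand-over box of stage 42. [cite: NedialkovJacksonCorliss1999, §5 Algorithm I] -/
theorem uok41b : boxLE (chain.certAt 41).endBox (chain.initAt 42) = true := (Bool.and_eq_true_iff.1 uok41).2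

/-- Stage 42 of the transcript: the elementary HOE step test AND the landing of its end box in the hand-over box of stage 43 — ONE kernel
evaluation. [cite: Moore1979, §8.1 eq. (8.10) with (8.13)] [cite: NedialkovJacksonCorliss1999, §5 Algorithm I] -/
theorem uok42 : ((chain.certAt 42).check && boxLE (chain.certAt 42).endBox (chain.initAt 43)) = true := by
  decide +kernel

/-- Stage 42 passes the step test. [cite: Moore1979, §8.1 eq. (8.10) with (8.13)] -/
theorem uok42c : (chain.certAt 42).check = true := (Bool.and_eq_true_iff.1 uok42).1

/-- The end box of stage 42 lands in the hand-over box of stage 43. [cite: NedialkovJacksonCorliss1999, §5 Algorithm I] -/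
theorem uok42b : boxLE (chain.certAt 42).endBox (chain.initAt 43) = true := (Bool.and_eq_true_iff.1 uok42).2

/-- Stage 43 of the transcript: the elementary HOE step test AND the landing of its end box in the hand-over box of stage 44 — ONE kernel
evaluation. [cite: Moore1979, §8.1 eq. (8.10) with (8.13)] [cite: NedialkovJacksonCorliss1999, §5 Algorithm I] -/
theorem uok43 : ((chain.certAt 43).check && boxLE (chain.certAt 43).endBox (chain.initAt 44)) = true := by
  decide +kernel

/-- Stage 43 passes the step test. [cite: Moore1979, §8.1 eq. (8.10) with (8.13)] -/
theorem uok43c : (chain.certAt 43).check = true := (Bool.and_eq_true_iff.1 uok43).1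

/-- The end box of stage 43 lands in the hand-over box of stage 44. [cite: NedialkovJacksonCorliss1999, §5 Algorithm I] -/
theorem uok43b : boxLE (chain.certAt 43).endBox (chain.initAt 44) = true := (Bool.and_eq_true_iff.1 uok43).2

/-- Stage 44 of the transcript: the elementary HOE step test AND the landing of its end box in the hand-over box of stage 45 — ONE kernel
evaluation. [cite: Moore1979, §8.1 eq. (8.10) with (8.13)] [cite: NedialkovJacksonCorliss1999, §5 Algorithm I] -/
theorem uok44 : ((chain.certAt 44).check && boxLE (chain.certAt 44).endBox (chain.initAt 45)) = true := by
  decide +kernel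

/-- Stage 44 passes the step test. [cite: Moore1979, §8.1 eq. (8.10) with (8.13)] -/
theorem uok44c : (chain.certAt 44).check = true := (Bool.and_eq_true_iff.1 uok44).1

/-- The end box of stage 44 lands in the hand-over box of stage 45. [cite: NedialkovJacksonCorliss1999, §5 Algorithm I] -/
theorem uok44b : boxLE (chain.certAt 44).endBox (chain.initAt 45) = true := (Bool.and_eq_true_iff.1 uok44).2

end Summit.Ventures.FusionMHD.Bench.SAlphaU067
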